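import Literature.NumberTheory.CubicFields.ReducibleMaximality
import Literature.NumberTheory.QuadraticFields.ThreeTorsionMean
import HarnessLib

/-!
# Counting maximal reducible cubic rings: `N₂^±(X)` (BTT Prop. 4.2, the reducible contribution)

Topic `Literature/NumberTheory/CubicFields`; the junction of `ReducibleMaximality.lean` (the
`GL₂(ℤ)`-orbits of maximal, reducible, nondegenerate integral binary cubic forms are classified by
their discriminant, which runs over the fundamental discriminants and `1`) with the quadratic side
`Literature/NumberTheory/QuadraticFields/ThreeTorsionMean.lean` (the finsets `negFundDiscrs X`,
`posFundDiscrs X` of fundamental discriminants in `(−X, 0)`, `(0, X)`, whose cardinalities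
`N₂^±(X) = (3/π²) X + O(√X)` are proved in `ThreeTorsionMeanProofs.lean`).

Bhargava–Taniguchi–Thorne 2023, §4 and Prop. 4.2: the maximal cubic rings that are not integral
domains are the maximal orders of `ℚ × K` (`K` quadratic) and of `ℚ³`; with `0 < ±Disc < X` there
are `N₂^±(X)` of the former (`Disc = d_K`) and, for the sign `+`, one more (`ℤ³`, `Disc = 1`).
This file proves exactly this count:

* `negReducibleMaximalOrbits X`, `posReducibleMaximalOrbits X` — the sets of `GL₂(ℤ)`-orbits of
  maximal reducible forms `f` with `−X < Disc(f) < 0`, resp. `0 < Disc(f) < X`;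
* `card_negReducibleMaximalOrbits` — **`#{orbits, −X < Disc < 0} = #negFundDiscrs X = N₂⁻(X)`**;
* `card_posReducibleMaximalOrbits` — **`#{orbits, 0 < Disc < X} = #posFundDiscrs X + [X > 1] = N₂⁺(X) + O(1)`**.

## References

* M. Bhargava, T. Taniguchi, F. Thorne, *Improved error estimates for the Davenport–Heilbronn
  theorems*, Math. Ann. 389 (2024) = arXiv:2107.12819, §4, Prop. 4.2 [BhargavaTaniguchiThorne2023].
-/

namespace Literature.NumberTheory.CubicFields

open BinaryCubic RingOfForm Literature.NumberTheory.QuadraticFields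

/-- The `GL₂(ℤ)`-orbits of maximal reducible forms with `−X < Disc < 0` (the maximal orders of
`ℚ × K`, `K` imaginary quadratic with `|d_K| < X`). [cite: BhargavaTaniguchiThorne2023, §4 (reducible maximal cubic rings with 0 < −Disc < X)] -/
def negReducibleMaximalOrbits (X : ℕ) : Set (Set (BinaryCubic ℤ)) :=
  {O | ∃ f : BinaryCubic ℤ, O = gl2zOrbit f ∧ IsMaximal f ∧ ¬ f.IsIrreducible ∧ -(X : ℤ) < f.disc ∧ f.disc < 0}

/-- The `GL₂(ℤ)`-orbits of maximal reducible forms with `0 < Disc < X` (the maximal orders of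
`ℚ × K`, `K` real quadratic with `d_K < X`, and `ℤ³`). [cite: BhargavaTaniguchiThorne2023, §4 (reducible maximal cubic rings with 0 < Disc < X)] -/
def posReducibleMaximalOrbits (X : ℕ) : Set (Set (BinaryCubic ℤ)) :=
  {O | ∃ f : BinaryCubic ℤ, O = gl2zOrbit f ∧ IsMaximal f ∧ ¬ f.IsIrreducible ∧ 0 < f.disc ∧ f.disc < X}

/-- The discriminant of an orbit of maximal reducible nondegenerate forms determines the orbit. [folklore] -/
theorem gl2zOrbit_eq_of_disc_eq {f g : BinaryCubic ℤ} (hf : IsMaximal f) (hfr : ¬ f.IsIrreducible)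
    (hg : IsMaximal g) (hgr : ¬ g.IsIrreducible) (h0 : f.disc ≠ 0) (h : f.disc = g.disc) :
    gl2zOrbit f = gl2zOrbit g :=
  gl2zOrbit_eq_iff.mpr (gl2zEquiv_of_isMaximal_of_disc_eq hf hfr hg hgr h0 h)

/-- Forms with the same orbit have the same discriminant. [folklore] -/
theorem disc_eq_of_gl2zOrbit_eq {f g : BinaryCubic ℤ} (h : gl2zOrbit f = gl2zOrbit g) : f.disc = g.disc :=
  ((gl2zOrbit_eq_iff.mp h).disc_eq).symm

/-- **`N₂⁻(X)` counts the maximal reducible cubic rings with `−X < Disc < 0`**: their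
`GL₂(ℤ)`-orbits are in bijection, via `Disc`, with the fundamental discriminants in `(−X, 0)`
(BTT 2023, Prop. 4.2, the reducible rings; `Disc = 1 > 0` does not occur). [cite: BhargavaTaniguchiThorne2023, Proposition 4.2 (reducible maximal rings counted by N₂⁻(X))] -/
theorem card_negReducibleMaximalOrbits (X : ℕ) :
    Nat.card (negReducibleMaximalOrbits X) = (negFundDiscrs X).card := by
  classical
  -- the discriminant map to `negFundDiscrs X`
  have hmem : ∀ O : negReducibleMaximalOrbits X, O.2.choose.disc ∈ negFundDiscrs X := by
    rintro ⟨O, hO⟩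
    obtain ⟨-, hmax, hred, hlo, hhi⟩ := hO.choose_spec
    rw [mem_negFundDiscrs]
    refine ⟨⟨hlo, hhi⟩, ?_⟩
    rcases isFundamental_disc_of_isMaximal hmax hred hhi.ne with h | h1
    · exact h
    · omega
  let δ : negReducibleMaximalOrbits X → negFundDiscrs X := fun O => ⟨O.2.choose.disc, hmem O⟩
  have hδ : ∀ O : negReducibleMaximalOrbits X, ((δ O : negFundDiscrs X) : ℤ) = O.2.choose.disc := fun O => rfl
  rw [← Fintype.card_coe (negFundDiscrs X), ← Nat.card_eq_fintype_card]
  apply Nat.card_eq_of_bijective δ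
  constructor
  · rintro ⟨O, hO⟩ ⟨O', hO'⟩ h
    have hd : hO.choose.disc = hO'.choose.disc := by
      have := congrArg (fun D : negFundDiscrs X => (D : ℤ)) h
      simpa [hδ] using this
    obtain ⟨hOe, hmax, hred, -, hhi⟩ := hO.choose_spec
    obtain ⟨hOe', hmax', hred', -, -⟩ := hO'.choose_spec
    apply Subtype.ext
    change O = O'
    rw [hOe, hOe']
    exact gl2zOrbit_eq_of_disc_eq hmax hred hmax' hred' hhi.ne hd
  · rintro ⟨D, hD⟩
    rw [mem_negFundDiscrs] at hD
    obtain ⟨⟨hlo, hhi⟩, hfund⟩ := hD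
    obtain ⟨f, hmax, hred, hdisc⟩ := exists_isMaximal_reducible_of_isFundamental (Or.inl hfund)
    have hO : gl2zOrbit f ∈ negReducibleMaximalOrbits X :=
      ⟨f, rfl, hmax, hred, by rw [hdisc]; exact hlo, by rw [hdisc]; exact hhi⟩
    refine ⟨⟨gl2zOrbit f, hO⟩, Subtype.ext ?_⟩
    change hO.choose.disc = D
    rw [← hdisc]
    exact disc_eq_of_gl2zOrbit_eq hO.choose_spec.1.symm

/-- The set of orbits of maximal reducible forms with `−X < Disc < 0` is finite. [folklore] -/
theorem negReducibleMaximalOrbits_finite (X : ℕ) : (negReducibleMaximalOrbits X).Finite := by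
  classical
  have hmem : ∀ O : negReducibleMaximalOrbits X, O.2.choose.disc ∈ negFundDiscrs X := by
    rintro ⟨O, hO⟩
    obtain ⟨-, hmax, hred, hlo, hhi⟩ := hO.choose_spec
    rw [mem_negFundDiscrs]
    refine ⟨⟨hlo, hhi⟩, ?_⟩
    rcases isFundamental_disc_of_isMaximal hmax hred hhi.ne with h | h1
    · exact h
    · omega
  refine Set.finite_coe_iff.mp (Finite.of_injective (fun O : negReducibleMaximalOrbits X =>
    (⟨O.2.choose.disc, hmem O⟩ : negFundDiscrs X)) ?_)
  rintro ⟨O, hO⟩ ⟨O', hO'⟩ h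
  have hd : hO.choose.disc = hO'.choose.disc := congrArg (fun D : negFundDiscrs X => (D : ℤ)) h
  obtain ⟨hOe, hmax, hred, -, hhi⟩ := hO.choose_spec
  obtain ⟨hOe', hmax', hred', -, -⟩ := hO'.choose_spec
  apply Subtype.ext
  change O = O'
  rw [hOe, hOe']
  exact gl2zOrbit_eq_of_disc_eq hmax hred hmax' hred' hhi.ne hd

/-- `1` is not a fundamental discriminant (in the spelling of `ThreeTorsionMean.lean`). [folklore] -/
theorem one_not_mem_posFundDiscrs (X : ℕ) : (1 : ℤ) ∉ posFundDiscrs X := by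
  rw [mem_posFundDiscrs]
  rintro ⟨-, ⟨-, -, h⟩ | ⟨h4, -, -⟩⟩
  · exact h rfl
  · norm_num at h4

/-- **`N₂⁺(X) + 1` counts the maximal reducible cubic rings with `0 < Disc < X`** (for `X > 1`): their
`GL₂(ℤ)`-orbits are in bijection, via `Disc`, with the fundamental discriminants in `(0, X)` together
with `Disc = 1` (the ring `ℤ³`) — BTT 2023, Prop. 4.2, the reducible rings. [cite: BhargavaTaniguchiThorne2023, Proposition 4.2 (reducible maximal rings counted by N₂⁺(X) + O(1))] -/
theorem card_posReducibleMaximalOrbits (X : ℕ) :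
    Nat.card (posReducibleMaximalOrbits X) = (posFundDiscrs X).card + if 1 < X then 1 else 0 := by
  classical
  -- the target finset `posFundDiscrs X ∪ {1 | 1 < X}`
  let T : Finset ℤ := posFundDiscrs X ∪ (if 1 < X then {1} else ∅)
  have hT : ∀ D, D ∈ T ↔ D ∈ posFundDiscrs X ∨ (D = 1 ∧ 1 < X) := by
    intro D
    simp only [T, Finset.mem_union]
    split_ifs with h <;> simp [h]
  have hTcard : T.card = (posFundDiscrs X).card + if 1 < X then 1 else 0 := by
    simp only [T]
    split_ifs with h
    · rw [Finset.card_union_of_disjoint (Finset.disjoint_singleton_right.mpr (one_not_mem_posFundDiscrs X)),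
        Finset.card_singleton]
    · rw [Finset.union_empty, add_zero]
  rw [← hTcard, ← Fintype.card_coe T, ← Nat.card_eq_fintype_card]
  -- the discriminant map
  have hmem : ∀ O : posReducibleMaximalOrbits X, O.2.choose.disc ∈ T := by
    rintro ⟨O, hO⟩
    obtain ⟨-, hmax, hred, hlo, hhi⟩ := hO.choose_spec
    rw [hT, mem_posFundDiscrs]
    rcases isFundamental_disc_of_isMaximal hmax hred hlo.ne' with h | h1
    · exact Or.inl ⟨⟨hlo, hhi⟩, h⟩
    · right
      refine ⟨h1, ?_⟩
      have : (1 : ℤ) < X := by rw [← h1]; exact hhi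
      exact_mod_cast this
  let δ : posReducibleMaximalOrbits X → T := fun O => ⟨O.2.choose.disc, hmem O⟩
  have hδ : ∀ O : posReducibleMaximalOrbits X, ((δ O : T) : ℤ) = O.2.choose.disc := fun O => rfl
  apply Nat.card_eq_of_bijective δ
  constructor
  · rintro ⟨O, hO⟩ ⟨O', hO'⟩ h
    have hd : hO.choose.disc = hO'.choose.disc := by
      have := congrArg (fun D : T => (D : ℤ)) h
      simpa [hδ] using this
    obtain ⟨hOe, hmax, hred, hlo, -⟩ := hO.choose_spec
    obtain ⟨hOe', hmax', hred', -, -⟩ := hO'.choose_spec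
    apply Subtype.ext
    change O = O'
    rw [hOe, hOe']
    exact gl2zOrbit_eq_of_disc_eq hmax hred hmax' hred' hlo.ne' hd
  · rintro ⟨D, hD⟩
    have hD' := (hT D).mp hD
    have hfund : ((D % 4 = 1 ∧ Squarefree D ∧ D ≠ 1) ∨ (4 ∣ D ∧ (D / 4 % 4 = 2 ∨ D / 4 % 4 = 3) ∧ Squarefree (D / 4)))
        ∨ D = 1 := by
      rcases hD' with h | ⟨h1, -⟩
      · exact Or.inl ((mem_posFundDiscrs.mp h).2)
      · exact Or.inr h1
    have hbounds : 0 < D ∧ D < X := by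
      rcases hD' with h | ⟨rfl, h1⟩
      · exact (mem_posFundDiscrs.mp h).1
      · exact ⟨one_pos, by exact_mod_cast h1⟩
    obtain ⟨f, hmax, hred, hdisc⟩ := exists_isMaximal_reducible_of_isFundamental hfund
    have hO : gl2zOrbit f ∈ posReducibleMaximalOrbits X :=
      ⟨f, rfl, hmax, hred, by rw [hdisc]; exact hbounds.1, by rw [hdisc]; exact hbounds.2⟩
    refine ⟨⟨gl2zOrbit f, hO⟩, Subtype.ext ?_⟩
    change hO.choose.disc = D
    rw [← hdisc]
    exact disc_eq_of_gl2zOrbit_eq hO.choose_spec.1.symm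

/-- The set of orbits of maximal reducible forms with `0 < Disc < X` is finite. [folklore] -/
theorem posReducibleMaximalOrbits_finite (X : ℕ) : (posReducibleMaximalOrbits X).Finite := by
  classical
  -- inject into `posFundDiscrs X ∪ {1}` by the discriminant
  have hmem : ∀ O : posReducibleMaximalOrbits X, O.2.choose.disc ∈ posFundDiscrs X ∪ {1} := by
    rintro ⟨O, hO⟩
    obtain ⟨-, hmax, hred, hlo, hhi⟩ := hO.choose_spec
    rw [Finset.mem_union, mem_posFundDiscrs, Finset.mem_singleton]
    rcases isFundamental_disc_of_isMaximal hmax hred hlo.ne' with h | h1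
    · exact Or.inl ⟨⟨hlo, hhi⟩, h⟩
    · exact Or.inr h1
  refine Set.finite_coe_iff.mp (Finite.of_injective (fun O : posReducibleMaximalOrbits X =>
    (⟨O.2.choose.disc, hmem O⟩ : (posFundDiscrs X ∪ {1} : Finset ℤ))) ?_)
  rintro ⟨O, hO⟩ ⟨O', hO'⟩ h
  have hd : hO.choose.disc = hO'.choose.disc := congrArg (fun D : (posFundDiscrs X ∪ {1} : Finset ℤ) => (D : ℤ)) h
  obtain ⟨hOe, hmax, hred, hlo, -⟩ := hO.choose_spec
  obtain ⟨hOe', hmax', hred', -, -⟩ := hO'.choose_spec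
  apply Subtype.ext
  change O = O'
  rw [hOe, hOe']
  exact gl2zOrbit_eq_of_disc_eq hmax hred hmax' hred' hlo.ne' hd

end Literature.NumberTheory.CubicFields
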